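import Literature.Probability.Percolation.Z2PivotalCampbellLimit
import Literature.Probability.Percolation.BondPercolationSymmetry
import Literature.Probability.Percolation.LatticeSymmetry
import Literature.Probability.LatticeModels.InterfaceSLETightness
import Summits.CriticalPhenomena.CardyFormulaZ2.Theorems.CardyMeckeFlipFlipErgodicityZ2StubLatticePivotalAntitone
import Summits.CriticalPhenomena.CardyFormulaZ2.Theorems.CardyMeckeFlipFlipErgodicityZ2StubLatticeSecondMomentEdgeArm
import Summits.CriticalPhenomena.CardyFormulaZ2.Theorems.CardyMeckeFlipZ2LimitsSymmetricIsometryOfRotation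

/-!
# Crux `FlipErgodicityZ2` (stmt-CriticalPhenomena-14825), line `registered`, stub
# `stub_equivariantVersion` (N7): exact covariance of the averaged pivotal measures of bond-`ℤ²`
# under lattice translations

Route `Summits/CriticalPhenomena/CardyFormulaZ2/Theses/CardyMeckeFlip`.  Helper file (supports the
crux item).  Clause (ADM)(6) of the crux asks for an ISOMETRY-EQUIVARIANT version of the
Garban–Pete–Schramm pivotal kernel of a bond-`ℤ²` sublimit.  This file is its exact LATTICE side
for the translations of `δℤ²`: shifting a bond configuration `ω` by a lattice vector `t ∈ ℤ²`
(`ω ↦ ω + t`, the tree's `BondConfig.relabel (sym2Equiv (Site.shift t)) ω`) translates the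
isometry-averaged normalised `ε`-important measure `μ^ε_δ(ω) = z2PivotalMeasure ε δ ω` by the
drawn vector `δ t = meshPoint δ t`:

* `pivotalWeight_relabel_shift` — the averaged weight of the shifted edge `s(x + t, x + t + eᵢ)` in
  `ω + t` equals the weight of `s(x, x + eᵢ)` in `ω`.  The edge four-arm event is transported by the
  graph automorphism (`relabel_mem_edgeFourArm`); the `3ε`-block of the moved grid `(θ, s, a)` around
  the shifted midpoint `m + δt` is the shift by `t` of the block of the grid `(θ, s, a - y_{θ,s}(δt)/ε)`
  around `m` (`gridCoord` is affine), and the induced displacement `a ↦ a - y_{θ,s}(δt)/ε` of the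
  shift parameter — reduced modulo `ℤ²`, a skew translation of the torus of shifts over the angle —
  preserves the parameter law (`map_gridParamLaw_skew` of the antitonicity file;
  `gridParamLaw_setOf_add_eq`, stated for any `ℤ²`-periodic family of parameter sets, by two
  applications of the outer-measure inequality `Measure.le_map_apply`);
* `z2PivotalMeasure_relabel_shift` — **`μ^ε_δ(ω + t) = (z ↦ δt + z)_* μ^ε_δ(ω)`** (E1);
* `z2QuadConfig_relabel_shift` — `(ω + t)_δ = T_{δt} ω_δ` in `ℋ_ℂ` (`z2QuadConfig_relabel`);
* `integral_comp_translate_eq_integral_comp_shift_testFunction` — the resulting EXACT identity of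
  joint laws (E2a): for every lattice vector `w = δt` and every functional `G` of the pair
  (configuration, finitely many integrals of test functions against the pivotal measures),
  `E G(T_{-w} ω_δ, (⟨μ^{εⱼ}_δ(ω), φⱼ⟩)ⱼ) = E G(ω_δ, (⟨μ^{εⱼ}_δ(ω), φⱼ(w + ·)⟩)ⱼ)` — translation
  invariance of `P_½` (`bondPercolation_map_shift`) and the two covariances; the registered
  headline `jointLaw_translate_lattice` is its closed form.

References: C. Garban, G. Pete, O. Schramm, JAMS 26 (2013), arXiv:1008.1378, §1 p. 10 and §4.3
(averaging the `ε`-grid over shifts and rotations makes the kernel equivariant); G. Grimmett,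
*Percolation* (1999), §1.6 (invariance of `P_p` under lattice symmetries).
-/

noncomputable section

open MeasureTheory Set Filter Metric
open Literature.Probability.Percolation Literature.Probability.Percolation.QuadCrossing
open Literature.Probability.LatticeModels Literature.Probability.Distributions
open Summit.CriticalPhenomena.CardyFormulaZ2.Cruxes.LagHandOff.CrosscutDictionary
open scoped ENNReal Topology

namespace Summit.CriticalPhenomena.CardyFormulaZ2.Theorems.CardyMeckeFlip

/-! ### Drawing shifted sites and edges -/

/-- The midpoint of the shifted edge is the shifted midpoint:
`mid_δ(x + t, i) = δt + mid_δ(x, i)`. [folklore] -/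
theorem edgeMidpoint_add (δ : ℝ) (x t : Site 2) (i : Fin 2) :
    edgeMidpoint δ (x + t) i = meshPoint δ t + edgeMidpoint δ x i := by
  simp only [edgeMidpoint, add_right_comm x t, meshPoint_add]
  ring

/-! ### Moved grids seen from a translated point -/

/-- The grid frame is additive. [folklore] -/
theorem gridFrame_add (θ : ℝ) (s : Bool) (c z : ℂ) :
    gridFrame θ s (c + z) = gridFrame θ s c + gridFrame θ s z := by
  have h := gridFrame_sub θ s (c + z) c
  rw [add_sub_cancel_left] at h
  linear_combination h

/-- **Grid coordinates of a translated point** are the grid coordinates of the point for the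
grid whose shift parameter is displaced by the frame coordinates of the translation vector:
`gc_{a}(c + z) = gc_{a - y(c)/ε}(z)`. [folklore] -/
theorem gridCoord_const_add (ε θ : ℝ) (s : Bool) (a c z : ℂ) :
    gridCoord ε θ s a (c + z) = gridCoord ε θ s (a - gridFrame θ s c / ε) z := by
  simp only [gridCoord, gridFrame_add]
  ring

/-- … hence so is the index of the square containing it. [folklore] -/
theorem gridIndex_const_add (ε θ : ℝ) (s : Bool) (a c z : ℂ) :
    gridIndex ε θ s a (c + z) = gridIndex ε θ s (a - gridFrame θ s c / ε) z := by
  simp only [gridIndex, gridCoord_const_add]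

/-- **The `3ε`-blocks of the moved grid are the shifts by `t` of the blocks of the displaced
grid** (displacement `y(δt)/ε` of the shift parameter). [folklore] -/
theorem image_shift_gridBlock (ε θ : ℝ) (s : Bool) (a : ℂ) (δ : ℝ) (t : Site 2) (k : ℤ × ℤ) :
    Site.shift t '' gridBlock ε θ s (a - gridFrame θ s (meshPoint δ t) / ε) δ k =
      gridBlock ε θ s a δ k := by
  ext v
  simp only [mem_image, gridBlock, mem_setOf_eq, Site.shift_apply]
  constructor
  · rintro ⟨u, hu, rfl⟩
    rwa [meshPoint_add, add_comm (meshPoint δ u), gridCoord_const_add]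
  · intro hv
    refine ⟨v - t, ?_, sub_add_cancel v t⟩
    have e : meshPoint δ v = meshPoint δ t + meshPoint δ (v - t) := by
      rw [← meshPoint_add, add_sub_cancel]
    rwa [e, gridCoord_const_add] at hv

/-- Shifting back undoes the shift of a bond configuration. [folklore] -/
theorem relabel_shift_symm_relabel_shift (t : Site 2) (ω : BondConfig (Site 2)) :
    BondConfig.relabel (sym2Equiv (Site.shift t).symm)
        (BondConfig.relabel (sym2Equiv (Site.shift t)) ω) = ω :=
  relabel_symm_relabel (Site.shift t) ω

/-- **`ε`-importance is transported by lattice translations**: the shifted edge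
`s(x + t, x + t + eᵢ)` is `ε`-important in `ω + t` for the moved grid `(θ, s, a)` iff
`s(x, x + eᵢ)` is `ε`-important in `ω` for the grid `(θ, s, a - y_{θ,s}(δt)/ε)`. [folklore] -/
theorem relabel_shift_mem_gridImportant_iff (ε θ : ℝ) (s : Bool) (a : ℂ) (δ : ℝ) (t x : Site 2)
    (i : Fin 2) (ω : BondConfig (Site 2)) :
    BondConfig.relabel (sym2Equiv (Site.shift t)) ω ∈ gridImportant ε θ s a δ (x + t) i ↔
      ω ∈ gridImportant ε θ s (a - gridFrame θ s (meshPoint δ t) / ε) δ x i := by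
  set a' := a - gridFrame θ s (meshPoint δ t) / ε with ha'
  have hW : gridBlock ε θ s a δ (gridIndex ε θ s a (edgeMidpoint δ (x + t) i)) =
      Site.shift t '' gridBlock ε θ s a' δ (gridIndex ε θ s a' (edgeMidpoint δ x i)) := by
    rw [image_shift_gridBlock, edgeMidpoint_add, gridIndex_const_add]
  unfold gridImportant
  rw [hW]
  constructor
  · intro h
    have key := relabel_mem_edgeFourArm (zdShiftIso t).symm
      (W := Site.shift t '' gridBlock ε θ s a' δ (gridIndex ε θ s a' (edgeMidpoint δ x i)))
      (x := x + t) (i := i) (j := i) (ω := BondConfig.relabel (sym2Equiv (Site.shift t)) ω)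
      (by
        show x + t + Pi.single i 1 + -t = x + t + -t + Pi.single i 1
        abel) h
    have e1 : ((zdShiftIso t).symm.toEquiv : Site 2 → Site 2) '' (Site.shift t ''
        gridBlock ε θ s a' δ (gridIndex ε θ s a' (edgeMidpoint δ x i))) =
        gridBlock ε θ s a' δ (gridIndex ε θ s a' (edgeMidpoint δ x i)) :=
      Equiv.symm_image_image (Site.shift t) _
    have e2 : (zdShiftIso t).symm.toEquiv (x + t) = x := by
      show x + t + -t = x
      abel
    rwa [e1, e2, show (zdShiftIso t).symm.toEquiv = (Site.shift t).symm from rfl,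
      relabel_shift_symm_relabel_shift] at key
  · intro h
    exact relabel_mem_edgeFourArm (zdShiftIso t)
      (W := gridBlock ε θ s a' δ (gridIndex ε θ s a' (edgeMidpoint δ x i))) (x := x) (i := i)
      (j := i) (by
        show x + Pi.single i 1 + t = x + t + Pi.single i 1
        abel) h

/-! ### Displacing the shift parameter preserves the parameter law -/

/-- The skew translation of the shifts over the angle, reduced modulo `ℤ²`. [folklore] -/
theorem gridShift_skew (d : ℝ → ℂ) (q : ℝ × ℝ × ℝ) :
    gridShift (q.1, Int.fract (q.2.1 + (d q.1).re), Int.fract (q.2.2 + (d q.1).im)) =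
      gridShift q + d q.1 +
        ⟨((-⌊q.2.1 + (d q.1).re⌋ : ℤ) : ℝ), ((-⌊q.2.2 + (d q.1).im⌋ : ℤ) : ℝ)⟩ := by
  apply Complex.ext
  · simp only [gridShift, Complex.add_re, Int.cast_neg, Int.fract]
    ring
  · simp only [gridShift, Complex.add_im, Int.cast_neg, Int.fract]
    ring

/-- **One-sided invariance.**  For a family `T` of parameters `(θ, a)` that is `ℤ²`-periodic in
the shift `a` and a measurable displacement `d(θ)`, the parameters `q` with
`(θ_q, a_q + d(θ_q)) ∈ T` have `gridParamLaw`-measure at most that of the parameters with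
`(θ_q, a_q) ∈ T`: the former set is the preimage of the latter under the law-preserving skew
translation `(θ, a) ↦ (θ, fract (a + d θ))` (`map_gridParamLaw_skew`), and
`Measure.le_map_apply` is an inequality of outer measures (no measurability of `T`). [folklore] -/
theorem gridParamLaw_setOf_add_le {T : Set (ℝ × ℂ)}
    (hT : ∀ (θ : ℝ) (a : ℂ) (k₁ k₂ : ℤ), (θ, a + ⟨(k₁ : ℝ), (k₂ : ℝ)⟩) ∈ T ↔ (θ, a) ∈ T)
    {d : ℝ → ℂ} (hd : Measurable d) :
    gridParamLaw {q | (q.1, gridShift q + d q.1) ∈ T} ≤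
      gridParamLaw {q | (q.1, gridShift q) ∈ T} := by
  have hmp := measurePreserving_gridParam_skew hd
  have hpre : {q : ℝ × ℝ × ℝ | (q.1, gridShift q + d q.1) ∈ T} =
      (fun q : ℝ × ℝ × ℝ =>
        (q.1, Int.fract (q.2.1 + (d q.1).re), Int.fract (q.2.2 + (d q.1).im))) ⁻¹'
        {q | (q.1, gridShift q) ∈ T} := by
    ext q
    simp only [mem_setOf_eq, mem_preimage]
    rw [gridShift_skew]
    exact (hT q.1 (gridShift q + d q.1) _ _).symm
  rw [hpre]
  exact (Measure.le_map_apply hmp.measurable.aemeasurable _).trans_eq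
    (by rw [map_gridParamLaw_skew hd])

/-- **Displacing the shift parameter by a measurable function of the angle does not change the
`gridParamLaw`-measure of a `ℤ²`-periodic family of parameters** (the displacement, reduced modulo
`ℤ²`, is a measure-preserving skew translation of the torus of shifts; two applications of
`gridParamLaw_setOf_add_le`, the second to the displaced family and `-d`). [folklore] -/
theorem gridParamLaw_setOf_add_eq {T : Set (ℝ × ℂ)}
    (hT : ∀ (θ : ℝ) (a : ℂ) (k₁ k₂ : ℤ), (θ, a + ⟨(k₁ : ℝ), (k₂ : ℝ)⟩) ∈ T ↔ (θ, a) ∈ T)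
    {d : ℝ → ℂ} (hd : Measurable d) :
    gridParamLaw {q | (q.1, gridShift q + d q.1) ∈ T} =
      gridParamLaw {q | (q.1, gridShift q) ∈ T} := by
  refine le_antisymm (gridParamLaw_setOf_add_le hT hd) ?_
  -- the displaced family `T' = {(θ, a) | (θ, a + d θ) ∈ T}` and the displacement `-d`
  have hT' : ∀ (θ : ℝ) (a : ℂ) (k₁ k₂ : ℤ),
      (θ, a + ⟨(k₁ : ℝ), (k₂ : ℝ)⟩) ∈ {p : ℝ × ℂ | (p.1, p.2 + d p.1) ∈ T} ↔
        (θ, a) ∈ {p : ℝ × ℂ | (p.1, p.2 + d p.1) ∈ T} := by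
    intro θ a k₁ k₂
    simp only [mem_setOf_eq]
    rw [add_right_comm]
    exact hT θ (a + d θ) k₁ k₂
  have h := gridParamLaw_setOf_add_le hT' hd.neg
  simp only [mem_setOf_eq, Pi.neg_apply, neg_add_cancel_right] at h
  exact h

/-! ### Covariance of the averaged weights and measures -/

/-- **The averaged weight of the shifted edge in the shifted configuration is the weight of the
edge**: `w^{ε,δ}_{ω+t}(x + t, i) = w^{ε,δ}_ω(x, i)` (transport of importance,
`relabel_shift_mem_gridImportant_iff`, and invariance of the parameter law under the induced
displacement of the shift, `gridParamLaw_setOf_add_eq`). [folklore] -/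
theorem pivotalWeight_relabel_shift (ε δ : ℝ) (ω : BondConfig (Site 2)) (t x : Site 2)
    (i : Fin 2) :
    pivotalWeight ε δ (BondConfig.relabel (sym2Equiv (Site.shift t)) ω) (x + t) i =
      pivotalWeight ε δ ω x i := by
  have key : ∀ s : Bool,
      gridParamLaw {q | BondConfig.relabel (sym2Equiv (Site.shift t)) ω ∈
          gridImportant ε q.1 s (gridShift q) δ (x + t) i} =
        gridParamLaw {q | ω ∈ gridImportant ε q.1 s (gridShift q) δ x i} := by
    intro s
    have hd : Measurable fun θ : ℝ => -(gridFrame θ s (meshPoint δ t) / ε) :=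
      ((continuous_gridFrame s _).div_const _).neg.measurable
    have hT : ∀ (θ : ℝ) (a : ℂ) (k₁ k₂ : ℤ),
        (θ, a + ⟨(k₁ : ℝ), (k₂ : ℝ)⟩) ∈ {p : ℝ × ℂ | ω ∈ gridImportant ε p.1 s p.2 δ x i} ↔
          (θ, a) ∈ {p : ℝ × ℂ | ω ∈ gridImportant ε p.1 s p.2 δ x i} := by
      intro θ a k₁ k₂
      simp only [mem_setOf_eq]
      exact Iff.of_eq (congrArg (ω ∈ ·) (gridImportant_add_int ε θ s a δ (k₁, k₂) x i))
    have h := gridParamLaw_setOf_add_eq hT hd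
    simp only [mem_setOf_eq] at h
    simp only [relabel_shift_mem_gridImportant_iff, sub_eq_add_neg]
    exact h
  simp only [pivotalWeight, key]

/-- **(E1) Exact covariance of the averaged pivotal measure under lattice translations**:
`μ^ε_δ(ω + t) = (z ↦ δt + z)_* μ^ε_δ(ω)` for every `t ∈ ℤ²` (reindex the sum of weighted Dirac
masses by `(x, i) ↦ (x + t, i)`; `pivotalWeight_relabel_shift`, `edgeMidpoint_add`). [folklore] -/
theorem z2PivotalMeasure_relabel_shift (ε δ : ℝ) (ω : BondConfig (Site 2)) (t : Site 2) :
    z2PivotalMeasure ε δ (BondConfig.relabel (sym2Equiv (Site.shift t)) ω) =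
      (z2PivotalMeasure ε δ ω).map (fun z => meshPoint δ t + z) := by
  refine Measure.ext fun B hB => ?_
  rw [Measure.map_apply (measurable_const_add (meshPoint δ t)) hB, z2PivotalMeasure_apply,
    z2PivotalMeasure_apply]
  let e : Site 2 × Fin 2 ≃ Site 2 × Fin 2 := (Site.shift t).prodCongr (Equiv.refl _)
  rw [← e.tsum_eq]
  refine tsum_congr fun p => ?_
  simp only [e, Equiv.prodCongr_apply, Prod.map_fst, Prod.map_snd, Equiv.coe_refl, id_eq,
    Site.shift_apply, pivotalWeight_relabel_shift, edgeMidpoint_add]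
  rfl

/-- Integrals against the shifted measure: `∫ f dμ^ε_δ(ω + t) = ∫ f(δt + z) dμ^ε_δ(ω)(dz)`, for
every `f` (translation is a Borel automorphism). [folklore] -/
theorem integral_z2PivotalMeasure_relabel_shift (ε δ : ℝ) (ω : BondConfig (Site 2)) (t : Site 2)
    (f : ℂ → ℝ) :
    ∫ z, f z ∂(z2PivotalMeasure ε δ (BondConfig.relabel (sym2Equiv (Site.shift t)) ω)) =
      ∫ z, f (meshPoint δ t + z) ∂(z2PivotalMeasure ε δ ω) := by
  rw [z2PivotalMeasure_relabel_shift]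
  exact integral_map_equiv (Homeomorph.addLeft (meshPoint δ t)).toMeasurableEquiv f

/-- **Shifting the configuration translates its point of `ℋ_ℂ`**: `(ω + t)_δ = T_{δt} ω_δ`
(`z2QuadConfig_relabel` for the translation automorphism, as in
`z2QuadLaw_map_translate_meshPoint`). [folklore] -/
theorem z2QuadConfig_relabel_shift (δ : ℝ) (t : Site 2) (ω : BondConfig (Site 2)) :
    z2QuadConfig (univ : Set ℂ) δ (BondConfig.relabel (sym2Equiv (Site.shift t)) ω) =
      QuadConfig.translate (meshPoint δ t) (z2QuadConfig (univ : Set ℂ) δ ω) := by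
  refine z2QuadConfig_relabel (zdShiftIso t) (Homeomorph.addLeft (meshPoint δ t)) δ
    (fun x y _ => ?_) ω
  have hfun : (⇑(Homeomorph.addLeft (meshPoint δ t)) : ℂ → ℂ) = fun z => meshPoint δ t + z := rfl
  rw [hfun, segment_translate_image]
  change _ = segment ℝ (meshPoint δ (x + t)) (meshPoint δ (y + t))
  rw [meshPoint_add, meshPoint_add, add_comm (meshPoint δ x), add_comm (meshPoint δ y)]

/-- `T_{-w} (T_w S) = S` on `ℋ_ℂ`. [folklore] -/
theorem translate_neg_translate (w : ℂ) (S : QuadConfig (univ : Set ℂ)) :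
    QuadConfig.translate (-w) (QuadConfig.translate w S) = S := by
  rw [← translate_add, neg_add_cancel, translate_zero]

/-- `T_w (T_{-w} S) = S` on `ℋ_ℂ`. [folklore] -/
theorem translate_translate_neg (w : ℂ) (S : QuadConfig (univ : Set ℂ)) :
    QuadConfig.translate w (QuadConfig.translate (-w) S) = S := by
  rw [← translate_add, add_neg_cancel, translate_zero]

/-! ### (E2a) The exact identity of joint laws at lattice vectors -/

/-- **(E2a) Joint laws at lattice translations, exactly.**  For every mesh `δ`, lattice vector
`w = δt` (`t ∈ ℤ²`), cutoffs `εⱼ`, test functions `φⱼ` and EVERY functional `G` on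
`ℋ_ℂ × ℝ^m`,
`E G(T_{-w} ω_δ, (⟨μ^{εⱼ}_δ(ω), φⱼ⟩)ⱼ) = E G(ω_δ, (⟨μ^{εⱼ}_δ(ω), φⱼ(w + ·)⟩)ⱼ)`:
substitute `ω = ω' + t` (`P_½` is shift invariant, `bondPercolation_map_shift`; no measurability of
the integrand is needed along a measurable equivalence), then `(ω' + t)_δ = T_w ω'_δ`
(`z2QuadConfig_relabel_shift`) and `μ^ε_δ(ω' + t) = (w + ·)_* μ^ε_δ(ω')`
(`z2PivotalMeasure_relabel_shift`). [folklore] -/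
theorem integral_comp_translate_eq_integral_comp_shift_testFunction (δ : ℝ) (t : Site 2) {m : ℕ}
    (εs : Fin m → ℝ) (φ : Fin m → ℂ → ℝ)
    (G : QuadConfig (univ : Set ℂ) × (Fin m → ℝ) → ℝ) :
    ∫ ω, G (QuadConfig.translate (-meshPoint δ t) (z2QuadConfig (univ : Set ℂ) δ ω),
        fun j => ∫ x, φ j x ∂(z2PivotalMeasure (εs j) δ ω)) ∂(bondPercolation (zdGraph 2) half) =
      ∫ ω, G (z2QuadConfig (univ : Set ℂ) δ ω,
        fun j => ∫ x, φ j (meshPoint δ t + x) ∂(z2PivotalMeasure (εs j) δ ω))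
          ∂(bondPercolation (zdGraph 2) half) := by
  conv_lhs => rw [← bondPercolation_map_shift (d := 2) t half]
  rw [integral_map_equiv]
  refine integral_congr_ae (ae_of_all _ fun ω => ?_)
  dsimp only
  rw [z2QuadConfig_relabel_shift, translate_neg_translate]
  simp only [integral_z2PivotalMeasure_relabel_shift]

/-- **Registered helper headline (N7, lattice side; verbatim signature)** — the exact identity of
joint laws at lattice translations, `integral_comp_translate_eq_integral_comp_shift_testFunction`
in closed form: for every mesh `δ`, `t ∈ ℤ²`, cutoffs, test functions and every functional `G`,
`E G(T_{-δt} ω_δ, (⟨μ^{εⱼ}_δ(ω), φⱼ⟩)ⱼ) = E G(ω_δ, (⟨μ^{εⱼ}_δ(ω), φⱼ(δt + ·)⟩)ⱼ)`. [folklore] -/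
theorem jointLaw_translate_lattice :
    ∀ (δ : ℝ) (t : Site 2) (m : ℕ) (εs : Fin m → ℝ) (φ : Fin m → ℂ → ℝ)
      (G : QuadConfig (Set.univ : Set ℂ) × (Fin m → ℝ) → ℝ),
      ∫ ω, G (QuadConfig.translate (-meshPoint δ t) (z2QuadConfig (Set.univ : Set ℂ) δ ω),
          fun j => ∫ x, φ j x ∂(z2PivotalMeasure (εs j) δ ω)) ∂(bondPercolation (zdGraph 2) half) =
        ∫ ω, G (z2QuadConfig (Set.univ : Set ℂ) δ ω,
          fun j => ∫ x, φ j (meshPoint δ t + x) ∂(z2PivotalMeasure (εs j) δ ω))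
            ∂(bondPercolation (zdGraph 2) half) :=
  fun δ t _ εs φ G => integral_comp_translate_eq_integral_comp_shift_testFunction δ t εs φ G

end Summit.CriticalPhenomena.CardyFormulaZ2.Theorems.CardyMeckeFlip

end
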